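import Literature.Barriers.Parity.SiegelZeroDichotomyPairHLEq58Euler
import Literature.Barriers.Parity.SiegelZeroDichotomyPairHLMertens33b
import HarnessLib

/-!
# Tao–Teräväinen 2022, (5.7) at `k = 2`: the Euler product bound with a distinguished prime

Topic `Literature/Barriers/Parity`, sub-namespace `TaoTeravainen`; the arithmetic half of the proof
of (5.7) of Tao–Teräväinen (arXiv:2109.06291, §5, proof of Proposition 5.2) at `k = 2`, `ℓ = 0`,
companion of `…Eq58Euler.lean`. Everything here is PROVED.

The source: "`a_d := ∑_{d₁,…,d_k ≤ D} τ(d₁⋯d_k)^{O(1)} 𝔼_{n ≤ x} 1_{d∣n+h₁} ∏ 1_{d_j∣n+h_j} ν(n+h_j)` …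
Applying Lemma 3.4 … `f(σ) := ∑ τ([d,d₁]d₂⋯d_k)^{O(1)}/([d,d₁]d₂⋯d_k) ∏_{p∣dd₁⋯d_k} min(σ log_R p, 1)`.
Using Euler products (2.11) we can bound `f(σ) ≤ ∏_{p ≤ √(2x)} E_p(σ)` … If `p ≠ p₀`, then `d_(p) = 1`,
and `E_p(σ) ≤ 1 + O(min(σ log_R p,1)/p)`. From (3.3) we then have
`∏_{p ≤ √(2x)} E_p(σ) ≪ (1 + σ log_R √(2x))^{O(1)} E_{p₀}(σ) ≪ (log_R^{O(1)} x) σ^{O(1)} E_{p₀}(σ)`. Also,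
we have the crude bound `E_{p₀}(σ) ≪ τ(d)^{O(1)}/d`." Here `d = p₀^j` (`j = 1`: `d = p*`; `j = 2`: `d = p₀²`).
[cite: TaoTeravainen2021, §5 (proof of (5.7))]

* `gainWeight_lcm_le` — `gainWeight(R;([p₀^j,d₁],d₂);σ) ≤ 1944 p₀^{min(j,v_{p₀}d₁)}/p₀^j · gainWeight(R;(d₁,d₂);σ)`
  (`gcd(p₀^j,d₁) ≤ p₀^{min(j,v)}`, `ω([p₀^j,d₁]d₂) ≤ 1 + ω(d₁d₂)`, the extra gains are `≤ 1`);
* `twist p₀ j d₁ = p₀^{min(j,v_{p₀}d₁)}`, `locW₂'` (the local weight twisted at `p₀`),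
  `twist_mul_pairW_eq` (the twisted weight is again an Euler product), `sum_locW₂'_self_le`
  (`E_{p₀} ≤ 2^j (1+c_P/2)²`, via `c_{p₀}(i) p₀^{min(j,i)} ≤ 2^j c_2(i)`), and
* **`sum_twist_pairW_le`** — over the pairs of divisors of `Q_S(K)`, `S` the primes `≤ M'` (any
  `M' ≥ 2`, possibly beyond `R`): `∑ twist · Φ ≤ 2^j(1+c_P/2)² (1+σ)^{40N'} max(1, log M'/log R)^{N'} e^{25N'}`
  (`N' = ⌈c'_P⌉`), from `sum_divisors_pair_eq_prod` and the general (3.3) `sum_min_div_prime_le_general`.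
-/

noncomputable section

open Finset

namespace Literature.Barriers.Parity

namespace TaoTeravainen

/-! ### The modulus `[p₀^j, d₁]` -/

/-- `gcd(p₀^j, d₁) ≤ p₀^{min(j, v_{p₀} d₁)}` for a prime `p₀` and `d₁ ≠ 0`. [folklore] -/
theorem gcd_prime_pow_le {p₀ : ℕ} (hp : p₀.Prime) (j : ℕ) {d₁ : ℕ} (hd₁ : d₁ ≠ 0) :
    Nat.gcd (p₀ ^ j) d₁ ≤ p₀ ^ min j (d₁.factorization p₀) := by
  obtain ⟨i, hij, hi⟩ := (Nat.dvd_prime_pow hp).mp (Nat.gcd_dvd_left (p₀ ^ j) d₁)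
  have hiv : i ≤ d₁.factorization p₀ := by
    rw [← hp.pow_dvd_iff_le_factorization hd₁, ← hi]
    exact Nat.gcd_dvd_right _ _
  rw [hi]
  exact Nat.pow_le_pow_right hp.pos (le_min hij hiv)

/-- `1/[p₀^j, d₁] ≤ p₀^{min(j,v)}/(p₀^j d₁)`. [folklore] -/
theorem inv_lcm_prime_pow_le {p₀ : ℕ} (hp : p₀.Prime) (j : ℕ) {d₁ : ℕ} (hd₁ : d₁ ≠ 0) :
    ((Nat.lcm (p₀ ^ j) d₁ : ℕ) : ℝ)⁻¹ ≤
      (p₀ : ℝ) ^ min j (d₁.factorization p₀) / ((p₀ : ℝ) ^ j * d₁) := by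
  have hpj : p₀ ^ j ≠ 0 := pow_ne_zero _ hp.ne_zero
  have hlcm0 : Nat.lcm (p₀ ^ j) d₁ ≠ 0 := Nat.lcm_ne_zero hpj hd₁
  have hgcd0 : Nat.gcd (p₀ ^ j) d₁ ≠ 0 := Nat.gcd_ne_zero_right hd₁
  have hmul := Nat.gcd_mul_lcm (p₀ ^ j) d₁
  have hmulR : ((Nat.gcd (p₀ ^ j) d₁ : ℕ) : ℝ) * (Nat.lcm (p₀ ^ j) d₁ : ℕ) = (p₀ : ℝ) ^ j * d₁ := by
    exact_mod_cast hmul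
  have hg := gcd_prime_pow_le hp j hd₁
  have hgR : ((Nat.gcd (p₀ ^ j) d₁ : ℕ) : ℝ) ≤ (p₀ : ℝ) ^ min j (d₁.factorization p₀) := by
    exact_mod_cast hg
  have hlcm_pos : (0 : ℝ) < (Nat.lcm (p₀ ^ j) d₁ : ℕ) := by exact_mod_cast Nat.pos_of_ne_zero hlcm0
  have hden : (0 : ℝ) < (p₀ : ℝ) ^ j * d₁ := by
    have := hp.pos; have := Nat.pos_of_ne_zero hd₁; positivity
  rw [inv_eq_one_div, div_le_div_iff₀ hlcm_pos hden, one_mul, ← hmulR]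
  exact mul_le_mul_of_nonneg_right hgR hlcm_pos.le

/-- The prime factors of `[p₀^j, d₁] d₂` are among `p₀` and those of `d₁ d₂`. [folklore] -/
theorem primeFactors_lcm_mul_subset {p₀ : ℕ} (hp : p₀.Prime) (j : ℕ) {d₁ d₂ : ℕ} (hd₁ : d₁ ≠ 0)
    (hd₂ : d₂ ≠ 0) :
    (Nat.lcm (p₀ ^ j) d₁ * d₂).primeFactors ⊆ insert p₀ (d₁ * d₂).primeFactors := by
  intro p hpm
  have hpj : p₀ ^ j ≠ 0 := pow_ne_zero _ hp.ne_zero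
  rw [Nat.mem_primeFactors] at hpm
  obtain ⟨hpp, hdvd, -⟩ := hpm
  rw [Finset.mem_insert, Nat.mem_primeFactors]
  rcases (Nat.Prime.dvd_mul hpp).mp hdvd with h | h
  · -- `p ∣ lcm ∣ p₀^j d₁`
    have h2 : p ∣ p₀ ^ j * d₁ := h.trans (Nat.lcm_dvd_mul (p₀ ^ j) d₁)
    rcases (Nat.Prime.dvd_mul hpp).mp h2 with h3 | h3
    · exact Or.inl ((Nat.prime_dvd_prime_iff_eq hpp hp).mp (hpp.dvd_of_dvd_pow h3))
    · exact Or.inr ⟨hpp, h3.mul_right _, mul_ne_zero hd₁ hd₂⟩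
  · exact Or.inr ⟨hpp, h.mul_left _, mul_ne_zero hd₁ hd₂⟩

/-- **The modulus `[p₀^j, d₁]` costs at most `1944 p₀^{min(j,v_{p₀}d₁)}/p₀^j`**:
`gainWeight(R; ([p₀^j,d₁], d₂); σ) ≤ 1944 · p₀^{min(j, v_{p₀} d₁)}/p₀^j · gainWeight(R; (d₁,d₂); σ)`
(`σ ≥ 1`): "`E_{p₀}(σ) ≪ τ(d)^{O(1)}/d`" with the divisor structure made explicit.
[cite: TaoTeravainen2021, §5 (proof of (5.7): "the crude bound `E_{p₀}(σ) ≪ τ(d)^{O(1)}/d`")] -/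
theorem gainWeight_lcm_le {R : ℝ} (hR : 1 < R) {σ : ℝ} (hσ : 1 ≤ σ) {p₀ : ℕ} (hp : p₀.Prime)
    (j : ℕ) {d₁ d₂ : ℕ} (hd₁ : d₁ ≠ 0) (hd₂ : d₂ ≠ 0) :
    gainWeight R ![Nat.lcm (p₀ ^ j) d₁, d₂] σ ≤
      1944 * ((p₀ : ℝ) ^ min j (d₁.factorization p₀) / (p₀ : ℝ) ^ j) * gainWeight R ![d₁, d₂] σ := by
  classical
  have hσ0 : 0 ≤ σ := by linarith
  have hpj : p₀ ^ j ≠ 0 := pow_ne_zero _ hp.ne_zero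
  set e := Nat.lcm (p₀ ^ j) d₁ with he
  have he0 : e ≠ 0 := Nat.lcm_ne_zero hpj hd₁
  have hed : e * d₂ ≠ 0 := mul_ne_zero he0 hd₂
  have h12 : d₁ * d₂ ≠ 0 := mul_ne_zero hd₁ hd₂
  rw [gainWeight_eq_primeFactors hR hσ (d := ![e, d₂]) (by intro i; fin_cases i <;> simpa),
    gainWeight_eq_primeFactors hR hσ (d := ![d₁, d₂]) (by intro i; fin_cases i <;> simpa)]
  simp only [Matrix.cons_val_zero, Matrix.cons_val_one]
  -- the three comparisons
  have hω : (1944 : ℝ) ^ (e * d₂).primeFactors.card ≤ 1944 * (1944 : ℝ) ^ (d₁ * d₂).primeFactors.card := by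
    rw [← pow_succ']
    refine pow_le_pow_right₀ (by norm_num) ?_
    calc (e * d₂).primeFactors.card ≤ (insert p₀ (d₁ * d₂).primeFactors).card :=
          Finset.card_le_card (primeFactors_lcm_mul_subset hp j hd₁ hd₂)
      _ ≤ (d₁ * d₂).primeFactors.card + 1 := Finset.card_insert_le _ _
  have hinv : ((e : ℝ) * d₂)⁻¹ ≤ (p₀ : ℝ) ^ min j (d₁.factorization p₀) / (p₀ : ℝ) ^ j * ((d₁ : ℝ) * d₂)⁻¹ := by
    have h1 := inv_lcm_prime_pow_le hp j hd₁
    rw [← he] at h1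
    have hd₂0 : (0 : ℝ) < d₂ := by exact_mod_cast Nat.pos_of_ne_zero hd₂
    have hd₁0 : (0 : ℝ) < d₁ := by exact_mod_cast Nat.pos_of_ne_zero hd₁
    have hp0 : (0 : ℝ) < (p₀ : ℝ) ^ j := by have := hp.pos; positivity
    rw [mul_inv, mul_inv]
    calc (e : ℝ)⁻¹ * (d₂ : ℝ)⁻¹ ≤ (p₀ : ℝ) ^ min j (d₁.factorization p₀) / ((p₀ : ℝ) ^ j * d₁) * (d₂ : ℝ)⁻¹ :=
          mul_le_mul_of_nonneg_right h1 (by positivity)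
      _ = _ := by field_simp
  have hprod : ∏ p ∈ (e * d₂).primeFactors, gainMin R σ p ≤ ∏ p ∈ (d₁ * d₂).primeFactors, gainMin R σ p := by
    have hsub : (d₁ * d₂).primeFactors ⊆ (e * d₂).primeFactors :=
      Nat.primeFactors_mono (mul_dvd_mul_right (Nat.dvd_lcm_right _ _) _) hed
    rw [← Finset.prod_sdiff hsub]
    refine mul_le_of_le_one_left (Finset.prod_nonneg fun p hp =>
      gainMin_nonneg hR hσ0 (Nat.prime_of_mem_primeFactors hp).one_lt.le) ?_
    exact Finset.prod_le_one (fun p hp => gainMin_nonneg hR hσ0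
      (Nat.prime_of_mem_primeFactors (Finset.mem_sdiff.mp hp).1).one_lt.le) fun p _ => gainMin_le_one _ _ _
  have hprod0 : 0 ≤ ∏ p ∈ (e * d₂).primeFactors, gainMin R σ p :=
    Finset.prod_nonneg fun p hp => gainMin_nonneg hR hσ0 (Nat.prime_of_mem_primeFactors hp).one_lt.le
  have hA0 : 0 ≤ (p₀ : ℝ) ^ min j (d₁.factorization p₀) / (p₀ : ℝ) ^ j := by positivity
  calc (1944 : ℝ) ^ (e * d₂).primeFactors.card / ((e : ℝ) * d₂) * ∏ p ∈ (e * d₂).primeFactors, gainMin R σ p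
      = (1944 : ℝ) ^ (e * d₂).primeFactors.card * ((e : ℝ) * d₂)⁻¹ *
          ∏ p ∈ (e * d₂).primeFactors, gainMin R σ p := by rw [div_eq_mul_inv]
    _ ≤ (1944 * (1944 : ℝ) ^ (d₁ * d₂).primeFactors.card) *
          ((p₀ : ℝ) ^ min j (d₁.factorization p₀) / (p₀ : ℝ) ^ j * ((d₁ : ℝ) * d₂)⁻¹) *
          ∏ p ∈ (d₁ * d₂).primeFactors, gainMin R σ p := by
        refine mul_le_mul (mul_le_mul hω hinv (by positivity) (by positivity)) hprod hprod0 ?_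
        positivity
    _ = 1944 * ((p₀ : ℝ) ^ min j (d₁.factorization p₀) / (p₀ : ℝ) ^ j) *
          ((1944 : ℝ) ^ (d₁ * d₂).primeFactors.card / ((d₁ : ℝ) * d₂) *
            ∏ p ∈ (d₁ * d₂).primeFactors, gainMin R σ p) := by
        rw [div_eq_mul_inv (((1944 : ℝ)) ^ _)]
        ring


/-! ### The Euler product with a distinguished prime -/

/-- The twist `p₀^{min(j, v_{p₀} d₁)}` carried by the first modulus. [folklore] -/
def twist (p₀ j d₁ : ℕ) : ℝ :=
  (p₀ : ℝ) ^ min j (d₁.factorization p₀)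

/-- `twist ≥ 0`. [folklore] -/
theorem twist_nonneg (p₀ j d₁ : ℕ) : 0 ≤ twist p₀ j d₁ := by
  unfold twist; positivity

/-- The twisted local weight: `Φ_p` for `p ≠ p₀` and `Φ_{p₀}(i,i') p₀^{min(j,i)}` at `p₀`.
[cite: TaoTeravainen2021, §5 (proof of (5.7), the factors `E_p(σ)` and `E_{p₀}(σ)`)] -/
def locW₂' (R σ : ℝ) (P p₀ j p i i' : ℕ) : ℝ :=
  locW₂ R σ P p i i' * (if p = p₀ then (p₀ : ℝ) ^ min j i else 1)

/-- `twist · Φ = ∏_{p ∈ S} Φ'_p` for `d₁` with prime factors in `S`. [folklore] -/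
theorem twist_mul_pairW_eq {S : Finset ℕ} (R σ : ℝ) (P p₀ j : ℕ) {d₁ : ℕ} (h₁S : d₁.primeFactors ⊆ S)
    (d₂ : ℕ) :
    twist p₀ j d₁ * pairW S R σ P d₁ d₂ =
      ∏ p ∈ S, locW₂' R σ P p₀ j p (d₁.factorization p) (d₂.factorization p) := by
  classical
  unfold pairW locW₂'
  rw [Finset.prod_mul_distrib, Finset.prod_ite_eq', mul_comm]
  congr 1
  unfold twist
  by_cases hp : p₀ ∈ S
  · rw [if_pos hp]
  · rw [if_neg hp]
    have : d₁.factorization p₀ = 0 := by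
      have h : p₀ ∉ d₁.primeFactors := fun h => hp (h₁S h)
      rwa [← Nat.support_factorization, Finsupp.notMem_support_iff] at h
    rw [this]
    simp

/-- At the distinguished prime: `c_{p₀}(i) p₀^{min(j,i)} ≤ 2^j c_2(i)`. [folklore] -/
theorem locW_mul_twist_le (P : ℕ) {p₀ : ℕ} (hp : 2 ≤ p₀) (j i : ℕ) :
    locW P p₀ i * (p₀ : ℝ) ^ min j i ≤ 2 ^ j * locW P 2 i := by
  unfold locW
  have hp0 : (0 : ℝ) < p₀ := by exact_mod_cast (show 0 < p₀ by omega)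
  have hp2 : (2 : ℝ) ≤ p₀ := by exact_mod_cast hp
  have hnum : 0 ≤ ((i : ℝ) + 1) ^ P * (if 0 < i then (1944 : ℝ) else 1) := by
    have : (0 : ℝ) ≤ (if 0 < i then (1944 : ℝ) else 1) := by split_ifs <;> norm_num
    positivity
  -- reduce to `p₀^{min j i}/p₀^i ≤ 2^j/2^i`
  have key : (p₀ : ℝ) ^ min j i / (p₀ : ℝ) ^ i ≤ (2 : ℝ) ^ j / (2 : ℝ) ^ i := by
    rcases le_or_gt i j with hij | hij
    · rw [min_eq_right hij, div_self (by positivity)]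
      rw [le_div_iff₀ (by positivity), one_mul]
      exact pow_le_pow_right₀ (by norm_num) hij
    · rw [min_eq_left hij.le]
      obtain ⟨k, rfl⟩ := Nat.exists_eq_add_of_lt hij
      have e1 : (p₀ : ℝ) ^ j / (p₀ : ℝ) ^ (j + k + 1) = 1 / (p₀ : ℝ) ^ (k + 1) := by
        rw [show j + k + 1 = j + (k + 1) by ring, pow_add, div_mul_eq_div_div, div_self (by positivity)]
      have e2 : (2 : ℝ) ^ j / (2 : ℝ) ^ (j + k + 1) = 1 / (2 : ℝ) ^ (k + 1) := by
        rw [show j + k + 1 = j + (k + 1) by ring, pow_add, div_mul_eq_div_div, div_self (by positivity)]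
      rw [e1, e2]
      exact one_div_le_one_div_of_le (by positivity) (pow_le_pow_left₀ (by norm_num) hp2 _)
  push_cast
  calc ((i : ℝ) + 1) ^ P * (if 0 < i then (1944 : ℝ) else 1) / (p₀ : ℝ) ^ i * (p₀ : ℝ) ^ min j i
      = ((i : ℝ) + 1) ^ P * (if 0 < i then (1944 : ℝ) else 1) * ((p₀ : ℝ) ^ min j i / (p₀ : ℝ) ^ i) := by
        ring
    _ ≤ ((i : ℝ) + 1) ^ P * (if 0 < i then (1944 : ℝ) else 1) * ((2 : ℝ) ^ j / (2 : ℝ) ^ i) :=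
        mul_le_mul_of_nonneg_left key hnum
    _ = 2 ^ j * (((i : ℝ) + 1) ^ P * (if 0 < i then (1944 : ℝ) else 1) / ((2 : ℕ) : ℝ) ^ i) := by
        push_cast; ring

/-- `∑_{i ≤ K} c_p(i) ≤ 1 + c_P/p`. [folklore] -/
theorem sum_locW_le (P : ℕ) {p : ℕ} (hp : 2 ≤ p) (K : ℕ) :
    ∑ i ∈ Finset.range (K + 1), locW P p i ≤ 1 + cA P / p := by
  rw [Finset.sum_range_succ']
  simp only [locW_zero]
  linarith [sum_locW_succ_le P hp K]

/-- **The local sum at the distinguished prime**: `∑_{i,i' ≤ K} Φ_{p₀}(i,i') p₀^{min(j,i)} ≤ 2^j (1 + c_P/2)²`.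
[cite: TaoTeravainen2021, §5 (proof of (5.7): "`E_{p₀}(σ) ≪ τ(d)^{O(1)}/d`")] -/
theorem sum_locW₂'_self_le {R : ℝ} (hR : 1 < R) {σ : ℝ} (hσ : 0 ≤ σ) (P : ℕ) {p₀ : ℕ} (hp : 2 ≤ p₀)
    (j K : ℕ) :
    ∑ i ∈ Finset.range (K + 1), ∑ i' ∈ Finset.range (K + 1), locW₂' R σ P p₀ j p₀ i i' ≤
      2 ^ j * (1 + cA P / 2) ^ 2 := by
  have hμ0 : 0 ≤ gainMin R σ p₀ := gainMin_nonneg hR hσ (by omega)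
  have hμ1 : gainMin R σ p₀ ≤ 1 := gainMin_le_one _ _ _
  have hc := cA_pos P
  have hp0 : (0 : ℝ) < p₀ := by exact_mod_cast (show 0 < p₀ by omega)
  -- termwise: `Φ'(i,i') ≤ (2^j c_2(i)) c_{p₀}(i')`
  have hterm : ∀ i i' : ℕ, locW₂' R σ P p₀ j p₀ i i' ≤ (2 ^ j * locW P 2 i) * locW P p₀ i' := by
    intro i i'
    unfold locW₂' locW₂
    rw [if_pos rfl]
    have h1 : locW P p₀ i * locW P p₀ i' * (if 0 < i + i' then gainMin R σ p₀ else 1) ≤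
        locW P p₀ i * locW P p₀ i' := by
      refine mul_le_of_le_one_right (mul_nonneg (locW_nonneg _ _ _) (locW_nonneg _ _ _)) ?_
      split_ifs
      · exact hμ1
      · exact le_rfl
    calc locW P p₀ i * locW P p₀ i' * (if 0 < i + i' then gainMin R σ p₀ else 1) * (p₀ : ℝ) ^ min j i
        ≤ locW P p₀ i * locW P p₀ i' * (p₀ : ℝ) ^ min j i :=
          mul_le_mul_of_nonneg_right h1 (by positivity)
      _ = (locW P p₀ i * (p₀ : ℝ) ^ min j i) * locW P p₀ i' := by ring
      _ ≤ (2 ^ j * locW P 2 i) * locW P p₀ i' :=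
          mul_le_mul_of_nonneg_right (locW_mul_twist_le P hp j i) (locW_nonneg _ _ _)
  have h2 := sum_locW_le P (le_refl 2) K
  have hp₀ := sum_locW_le P hp K
  have hs2 : 0 ≤ ∑ i ∈ Finset.range (K + 1), locW P 2 i := Finset.sum_nonneg fun i _ => locW_nonneg _ _ _
  have hsp : 0 ≤ ∑ i ∈ Finset.range (K + 1), locW P p₀ i := Finset.sum_nonneg fun i _ => locW_nonneg _ _ _
  have hcp : cA P / p₀ ≤ cA P / 2 := div_le_div_of_nonneg_left hc.le two_pos (by exact_mod_cast hp)
  calc ∑ i ∈ Finset.range (K + 1), ∑ i' ∈ Finset.range (K + 1), locW₂' R σ P p₀ j p₀ i i'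
      ≤ ∑ i ∈ Finset.range (K + 1), ∑ i' ∈ Finset.range (K + 1), (2 ^ j * locW P 2 i) * locW P p₀ i' :=
        Finset.sum_le_sum fun i _ => Finset.sum_le_sum fun i' _ => hterm i i'
    _ = 2 ^ j * (∑ i ∈ Finset.range (K + 1), locW P 2 i) * ∑ i' ∈ Finset.range (K + 1), locW P p₀ i' := by
        rw [Finset.mul_sum (Finset.range (K + 1)) (fun i => locW P 2 i) (2 ^ j), Finset.sum_mul_sum]
    _ ≤ 2 ^ j * (1 + cA P / 2) * (1 + cA P / 2) := by
        refine mul_le_mul (mul_le_mul_of_nonneg_left (by simpa using h2) (by positivity)) (hp₀.trans (by linarith))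
          hsp (by positivity)
    _ = 2 ^ j * (1 + cA P / 2) ^ 2 := by ring

/-- The exponent `N'_P = ⌈c'_P⌉`. [folklore] -/
def expN' (P : ℕ) : ℕ :=
  ⌈cA' P⌉₊

/-- **The twisted Euler product bound**: for `S` the primes `≤ M'` (`M' ≥ 2`), `R ≥ 3`, `σ ≥ 1`,
a prime `p₀` and `j`, `K`:
`∑_{d₁,d₂ ∣ Q_S(K)} p₀^{min(j,v_{p₀}d₁)} Φ(d₁,d₂) ≤ 2^j (1+c_P/2)² (1+σ)^{40N'} max(1, log M'/log R)^{N'} e^{25N'}`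
("`∏_{p ≤ √(2x)} E_p(σ) ≪ (1 + σ log_R √(2x))^{O(1)} E_{p₀}(σ) ≪ (log_R^{O(1)} x) σ^{O(1)} E_{p₀}(σ)`").
[cite: TaoTeravainen2021, §5 (proof of (5.7))] -/
theorem sum_twist_pairW_le {M' : ℕ} (hM' : 2 ≤ M') {R : ℝ} (hR : 3 ≤ R) {σ : ℝ} (hσ : 1 ≤ σ)
    (P : ℕ) {p₀ : ℕ} (hp : p₀.Prime) (j K : ℕ) :
    ∑ d₁ ∈ (primePowerProd (Nat.primesBelow (M' + 1)) K).divisors,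
        ∑ d₂ ∈ (primePowerProd (Nat.primesBelow (M' + 1)) K).divisors,
          twist p₀ j d₁ * pairW (Nat.primesBelow (M' + 1)) R σ P d₁ d₂ ≤
      2 ^ j * (1 + cA P / 2) ^ 2 * ((1 + σ) ^ (40 * expN' P) *
        (max 1 (Real.log M' / Real.log R)) ^ expN' P * Real.exp (25 * expN' P)) := by
  classical
  set S := Nat.primesBelow (M' + 1) with hSdef
  set Q := primePowerProd S K with hQdef
  have hS : ∀ p ∈ S, p.Prime := fun p hp => (Nat.mem_primesBelow.mp hp).2
  have hR1 : 1 < R := by linarith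
  have hσ0 : 0 ≤ σ := by linarith
  have hQ0 : Q ≠ 0 := primePowerProd_ne_zero hS K
  -- Euler product
  have hE : ∑ d₁ ∈ Q.divisors, ∑ d₂ ∈ Q.divisors, twist p₀ j d₁ * pairW S R σ P d₁ d₂ =
      ∏ p ∈ S, ∑ i ∈ Finset.range (K + 1), ∑ i' ∈ Finset.range (K + 1), locW₂' R σ P p₀ j p i i' := by
    rw [← sum_divisors_pair_eq_prod hS K (fun p i i' => locW₂' R σ P p₀ j p i i')]
    refine Finset.sum_congr rfl fun d₁ hd₁ => Finset.sum_congr rfl fun d₂ _ => ?_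
    refine twist_mul_pairW_eq R σ P p₀ j (fun p hp => ?_) d₂
    -- prime factors of a divisor of `Q` lie in `S`
    have hd := factorization_le_of_dvd_primePowerProd hS (Nat.dvd_of_mem_divisors hd₁) p
    by_contra hpS
    rw [if_neg hpS] at hd
    have : d₁.factorization p ≠ 0 := by
      rwa [← Finsupp.mem_support_iff, Nat.support_factorization]
    omega
  rw [hE]
  -- local bounds
  set G : ℕ → ℝ := fun p => ∑ i ∈ Finset.range (K + 1), ∑ i' ∈ Finset.range (K + 1),
    locW₂' R σ P p₀ j p i i' with hGdef
  have hG0 : ∀ p ∈ S, 0 ≤ G p := by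
    intro p hp'
    refine Finset.sum_nonneg fun i _ => Finset.sum_nonneg fun i' _ => ?_
    unfold locW₂' locW₂
    refine mul_nonneg (mul_nonneg (mul_nonneg (locW_nonneg _ _ _) (locW_nonneg _ _ _)) ?_) ?_
    · split_ifs
      · exact gainMin_nonneg hR1 hσ0 (hS p hp').one_lt.le
      · exact zero_le_one
    · split_ifs <;> positivity
  have hGne : ∀ p ∈ S, p ≠ p₀ → G p ≤ Real.exp (cA' P * (gainMin R σ p / p)) := by
    intro p hp' hne
    have hplain : G p = ∑ i ∈ Finset.range (K + 1), ∑ i' ∈ Finset.range (K + 1), locW₂ R σ P p i i' := by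
      refine Finset.sum_congr rfl fun i _ => Finset.sum_congr rfl fun i' _ => ?_
      unfold locW₂'
      rw [if_neg hne, mul_one]
    rw [hplain]
    refine (sum_locW₂_le hR1 hσ0 P (hS p hp').two_le K).trans ?_
    have := Real.add_one_le_exp (cA' P * (gainMin R σ p / p))
    rw [mul_div_assoc] at *
    linarith
  have hexp1 : ∀ p ∈ S, 1 ≤ Real.exp (cA' P * (gainMin R σ p / p)) := fun p hp' =>
    Real.one_le_exp (mul_nonneg (cA'_pos P).le (div_nonneg (gainMin_nonneg hR1 hσ0 (hS p hp').one_lt.le)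
      (Nat.cast_nonneg p)))
  -- the product of the exponentials
  have hprodexp : ∏ p ∈ S, Real.exp (cA' P * (gainMin R σ p / p)) ≤
      (1 + σ) ^ (40 * expN' P) * (max 1 (Real.log M' / Real.log R)) ^ expN' P * Real.exp (25 * expN' P) := by
    rw [← Real.exp_sum, ← Finset.mul_sum]
    have h33 : ∑ p ∈ S, gainMin R σ p / p ≤
        40 * Real.log (1 + σ) + Real.log (max 1 (Real.log M' / Real.log R)) + 25 := by
      have := sum_min_div_prime_le_general hM' hR hσ
      simpa [gainMin] using this
    have hc := cA'_pos P
    have hceil : cA' P ≤ (expN' P : ℝ) := Nat.le_ceil _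
    have hlog1 : 0 ≤ Real.log (1 + σ) := Real.log_nonneg (by linarith)
    have hlogm : 0 ≤ Real.log (max 1 (Real.log M' / Real.log R)) := Real.log_nonneg (le_max_left _ _)
    have hmax0 : 0 < max 1 (Real.log M' / Real.log R) := lt_of_lt_of_le one_pos (le_max_left _ _)
    calc Real.exp (cA' P * ∑ p ∈ S, gainMin R σ p / p)
        ≤ Real.exp ((expN' P : ℝ) * (40 * Real.log (1 + σ) + Real.log (max 1 (Real.log M' / Real.log R)) + 25)) := by
          refine Real.exp_le_exp.mpr ?_
          calc cA' P * ∑ p ∈ S, gainMin R σ p / p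
              ≤ cA' P * (40 * Real.log (1 + σ) + Real.log (max 1 (Real.log M' / Real.log R)) + 25) :=
                mul_le_mul_of_nonneg_left h33 hc.le
            _ ≤ (expN' P : ℝ) * (40 * Real.log (1 + σ) + Real.log (max 1 (Real.log M' / Real.log R)) + 25) :=
                mul_le_mul_of_nonneg_right hceil (by positivity)
      _ = (1 + σ) ^ (40 * expN' P) * (max 1 (Real.log M' / Real.log R)) ^ expN' P * Real.exp (25 * expN' P) := by
          rw [show (expN' P : ℝ) * (40 * Real.log (1 + σ) + Real.log (max 1 (Real.log M' / Real.log R)) + 25) =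
              ((40 * expN' P : ℕ) : ℝ) * Real.log (1 + σ) + (expN' P : ℝ) * Real.log (max 1 (Real.log M' / Real.log R)) +
                25 * expN' P by push_cast; ring]
          rw [Real.exp_add, Real.exp_add, Real.exp_nat_mul, Real.exp_nat_mul, Real.exp_log (by linarith),
            Real.exp_log hmax0]
  have hprodexp0 : 0 ≤ ∏ p ∈ S, Real.exp (cA' P * (gainMin R σ p / p)) :=
    Finset.prod_nonneg fun p _ => (Real.exp_pos _).le
  have hB1 : 1 ≤ (2 : ℝ) ^ j * (1 + cA P / 2) ^ 2 := by
    have hc := cA_pos P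
    have h1 : (1 : ℝ) ≤ 2 ^ j := one_le_pow₀ (by norm_num)
    have h2 : (1 : ℝ) ≤ (1 + cA P / 2) ^ 2 := one_le_pow₀ (by linarith)
    nlinarith
  -- split off `p₀`
  by_cases hp₀ : p₀ ∈ S
  · rw [← Finset.mul_prod_erase S G hp₀]
    have hrest : ∏ p ∈ S.erase p₀, G p ≤ ∏ p ∈ S, Real.exp (cA' P * (gainMin R σ p / p)) := by
      calc ∏ p ∈ S.erase p₀, G p ≤ ∏ p ∈ S.erase p₀, Real.exp (cA' P * (gainMin R σ p / p)) :=
            Finset.prod_le_prod (fun p hp' => hG0 p (Finset.mem_of_mem_erase hp'))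
              fun p hp' => hGne p (Finset.mem_of_mem_erase hp') (Finset.ne_of_mem_erase hp')
        _ ≤ ∏ p ∈ S, Real.exp (cA' P * (gainMin R σ p / p)) := by
            rw [← Finset.mul_prod_erase S _ hp₀]
            exact le_mul_of_one_le_left (Finset.prod_nonneg fun p _ => (Real.exp_pos _).le) (hexp1 p₀ hp₀)
    have hself : G p₀ ≤ 2 ^ j * (1 + cA P / 2) ^ 2 := sum_locW₂'_self_le hR1 hσ0 P hp.two_le j K
    calc G p₀ * ∏ p ∈ S.erase p₀, G p ≤ (2 ^ j * (1 + cA P / 2) ^ 2) *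
          ∏ p ∈ S, Real.exp (cA' P * (gainMin R σ p / p)) :=
          mul_le_mul hself hrest (Finset.prod_nonneg fun p hp' => hG0 p (Finset.mem_of_mem_erase hp'))
            (by positivity)
      _ ≤ _ := mul_le_mul_of_nonneg_left hprodexp (by positivity)
  · have hall : ∏ p ∈ S, G p ≤ ∏ p ∈ S, Real.exp (cA' P * (gainMin R σ p / p)) :=
      Finset.prod_le_prod hG0 fun p hp' => hGne p hp' (fun h => hp₀ (h ▸ hp'))
    calc ∏ p ∈ S, G p ≤ 1 * ∏ p ∈ S, Real.exp (cA' P * (gainMin R σ p / p)) := by rw [one_mul]; exact hall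
      _ ≤ (2 ^ j * (1 + cA P / 2) ^ 2) * ∏ p ∈ S, Real.exp (cA' P * (gainMin R σ p / p)) :=
          mul_le_mul_of_nonneg_right hB1 hprodexp0
      _ ≤ _ := mul_le_mul_of_nonneg_left hprodexp (by positivity)

end TaoTeravainen

end Literature.Barriers.Parity
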